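import Summits.NavierStokesRegularity.NavierStokesRegularity.Theorems.ExtremiserTransienceMemberSelection
import Summits.NavierStokesRegularity.NavierStokesRegularity.Theorems.ExtremiserTransienceMemberSelectionTranslateCompactness
import Literature.Analysis.FluidPDE.TaoEnstrophyLocalisationProofs
import HarnessLib

/-!
# LINE g7-δ «member selection», T1 tool: THE LIMIT DICHOTOMY — exhaustion-efficiency ⇒ extremal slice ∨ tube slice

Crux `NearExtremalTransiencePerFlow` (stmt-NavierStokesRegularity-26567), line δ `member_selection`, stub T1
`stub_coherentSelection` (texts of record `IsExtremalSlice`, `IsTubeSlice` in `…Theorems.ExtremiserTransienceMemberSelection`).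
The BACK END of T1: once the nested selection and the exactness of the landed `exists_limit_of_nearExtremalFamily` have
produced a smooth divergence-free limit `W₀` (`‖W₀‖ ≤ M`, `‖DW₀‖ ≤ B`) that is `(κ⋆ − δ_k)`-efficient at height `M` on an
exhaustion `D_k ⊇ B(0, ρ_k)` by bounded measurable sets (`ρ_k → ∞`, `δ_k → 0`) and is not irrotational, the conclusion of
`CoherentSelection` follows by a case split on the budget:

* infinite budget (`D¹W₀ ∉ L²` or `D²W₀ ∉ L²`) ⇒ `IsTubeSlice W₀` VERBATIM (repackaging);
* finite budget ⇒ the three densities `‖curl W₀‖²`, `|D curl W₀|²_F`, `⟪curl W₀, DW₀ curl W₀⟫` are integrable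
  (`‖curl‖ ≤ ‖curlCLM‖‖D·‖`, `|D curl|²_F ≤ 3‖curlCLM‖²‖D²·‖²`, `|⟪ω,Sω⟫| ≤ B‖ω‖²`), the restricted integrals over the
  exhaustion converge to the full ones (dominated convergence), so `κ⋆·M·√Z·√P ≤ |J|` in the limit; and `Z, P > 0` because
  `curl W₀ ≢ 0` (if `P = 0` then `D curl W₀ ≡ 0`, `curl W₀` is a constant with `∫‖c‖² < ∞` on `ℝ³`, hence `0`) ⇒
  `IsExtremalSlice W₀` VERBATIM.

Main theorem: `isExtremalSlice_or_isTubeSlice_of_exhaustion`.  Pure analysis; nothing here is a statement about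
Navier–Stokes.  26567, T1, T3, NS regularity OPEN.  No summit is proved by a line.
-/

noncomputable section

open scoped Topology InnerProductSpace RealInnerProductSpace ENNReal ContDiff
open MeasureTheory Filter Set Metric
open Literature.Analysis.FluidPDE
open Summit.NavierStokesRegularity.NavierStokesRegularity.Theorems.DepletionLadder.KStar.HalfSpace

namespace Summit.NavierStokesRegularity.NavierStokesRegularity.Theorems.NearExtremalTransiencePerFlow.MemberSelection

set_option linter.dupNamespace false

/-! ### Restricted integrals over an exhaustion converge to the full integral -/

section Exhaustion

variable {E : Type*} [NormedAddCommGroup E] [MeasurableSpace E] {μ : Measure E}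

/-- If `f` is integrable and `D k ⊇ B(0, ρ k)` are measurable with `ρ k → ∞`, then `∫_{D k} f → ∫ f`. [folklore] -/
theorem tendsto_setIntegral_of_exhaustion {f : E → ℝ} (hf : Integrable f μ) {D : ℕ → Set E} {ρ : ℕ → ℝ}
    (hDm : ∀ k, MeasurableSet (D k)) (hball : ∀ k, Metric.ball 0 (ρ k) ⊆ D k) (hρ : Tendsto ρ atTop atTop) :
    Tendsto (fun k => ∫ x in D k, f x ∂μ) atTop (𝓝 (∫ x, f x ∂μ)) := by
  have hrew : ∀ k, ∫ x in D k, f x ∂μ = ∫ x, (D k).indicator f x ∂μ := fun k => (integral_indicator (hDm k)).symm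
  simp_rw [hrew]
  refine tendsto_integral_of_dominated_convergence (fun x => ‖f x‖) (fun k => (hf.indicator (hDm k)).aestronglyMeasurable)
    hf.norm ?_ ?_
  · exact fun k => Eventually.of_forall fun x => norm_indicator_le_norm_self _ _
  · refine Eventually.of_forall fun x => ?_
    have hev : ∀ᶠ k in atTop, (D k).indicator f x = f x := by
      filter_upwards [hρ.eventually_gt_atTop ‖x‖] with k hk
      exact indicator_of_mem (hball k (mem_ball_zero_iff.2 hk)) f
    exact tendsto_const_nhds.congr' (hev.mono fun k hk => hk.symm)

end Exhaustion

/-! ### Finite budgets make the three densities integrable -/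

section FiniteBudget

variable {W : EuclideanSpace ℝ (Fin 3) → EuclideanSpace ℝ (Fin 3)}

/-- `∫⁻ ‖Dⁱ W‖ₑ² < ⊤` ⇒ `x ↦ ‖Dⁱ W(x)‖²` is integrable (for continuous `Dⁱ W`). [folklore] -/
theorem integrable_sq_norm_iteratedFDeriv (hW : ContDiff ℝ ∞ W) (i : ℕ)
    (hfin : ∫⁻ x, ‖iteratedFDeriv ℝ i W x‖ₑ ^ 2 < ⊤) :
    Integrable (fun x => ‖iteratedFDeriv ℝ i W x‖ ^ 2) := by
  have hcont : Continuous fun x => iteratedFDeriv ℝ i W x :=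
    hW.continuous_iteratedFDeriv (by exact_mod_cast le_top)
  refine ⟨(hcont.norm.pow 2).aestronglyMeasurable, ?_⟩
  rw [hasFiniteIntegral_iff_enorm]
  have heq : ∀ x, ‖‖iteratedFDeriv ℝ i W x‖ ^ 2‖ₑ = ‖iteratedFDeriv ℝ i W x‖ₑ ^ 2 := fun x => by
    rw [Real.enorm_eq_ofReal (sq_nonneg _), ← ofReal_norm, ENNReal.ofReal_pow (norm_nonneg _)]
  simp_rw [heq]
  exact hfin

/-- Finite `D¹` budget ⇒ the enstrophy density `‖curl W‖²` is integrable. [folklore] -/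
theorem integrable_sq_norm_curl (hW : ContDiff ℝ ∞ W) (h1 : ∫⁻ x, ‖iteratedFDeriv ℝ 1 W x‖ₑ ^ 2 < ⊤) :
    Integrable (fun x => ‖curl W x‖ ^ 2) := by
  have hD := integrable_sq_norm_iteratedFDeriv hW 1 h1
  have hcurl : Continuous (curl W) := (contDiff_curl (n := 0) (contDiff_infty.1 hW 1)).continuous
  refine (hD.const_mul (‖curlCLM‖ ^ 2)).mono' (hcurl.norm.pow 2).aestronglyMeasurable (Eventually.of_forall fun x => ?_)
  rw [Real.norm_eq_abs, abs_of_nonneg (sq_nonneg _), ← norm_fderiv_eq_norm_iteratedFDeriv_one, ← mul_pow]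
  exact pow_le_pow_left₀ (norm_nonneg _) (norm_curl_le W x) 2

/-- Finite `D²` budget ⇒ the palinstrophy density `|D curl W|²_F` is integrable. [folklore] -/
theorem integrable_frobeniusNormSq_fderiv_curl' (hW : ContDiff ℝ ∞ W)
    (h2 : ∫⁻ x, ‖iteratedFDeriv ℝ 2 W x‖ₑ ^ 2 < ⊤) :
    Integrable (fun x => frobeniusNormSq (fderiv ℝ (curl W) x)) := by
  have hD := integrable_sq_norm_iteratedFDeriv hW 2 h2
  have hW2 : ContDiff ℝ 2 W := contDiff_infty.1 hW 2
  have hDcurl : Continuous (fderiv ℝ (curl W)) :=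
    (contDiff_curl (n := 1) (by exact_mod_cast hW2)).continuous_fderiv one_ne_zero
  refine (hD.const_mul (3 * ‖curlCLM‖ ^ 2)).mono' (continuous_frobeniusNormSq.comp hDcurl).aestronglyMeasurable
    (Eventually.of_forall fun x => ?_)
  rw [Real.norm_eq_abs, abs_of_nonneg (frobeniusNormSq_nonneg' _)]
  have h3 : ‖fderiv ℝ (curl W) x‖ ≤ ‖curlCLM‖ * ‖iteratedFDeriv ℝ 2 W x‖ := by
    rw [fderiv_curl_eq_comp hW2 x, ← norm_iteratedFDeriv_fderiv, ← norm_fderiv_eq_norm_iteratedFDeriv_one]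
    exact ContinuousLinearMap.opNorm_comp_le _ _
  calc frobeniusNormSq (fderiv ℝ (curl W) x)
      ≤ (Module.finrank ℝ (EuclideanSpace ℝ (Fin 3)) : ℝ) * ‖fderiv ℝ (curl W) x‖ ^ 2 := frobeniusNormSq_le_card_mul _
    _ = 3 * ‖fderiv ℝ (curl W) x‖ ^ 2 := by rw [finrank_euclideanSpace_fin]; norm_num
    _ ≤ 3 * (‖curlCLM‖ * ‖iteratedFDeriv ℝ 2 W x‖) ^ 2 := by gcongr
    _ = 3 * ‖curlCLM‖ ^ 2 * ‖iteratedFDeriv ℝ 2 W x‖ ^ 2 := by ring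

/-- Finite `D¹` budget and bounded gradient ⇒ the stretching density `⟪curl W, DW curl W⟫` is integrable. [folklore] -/
theorem integrable_stretching (hW : ContDiff ℝ ∞ W) {B : ℝ} (hB : ∀ x, ‖fderiv ℝ W x‖ ≤ B)
    (h1 : ∫⁻ x, ‖iteratedFDeriv ℝ 1 W x‖ₑ ^ 2 < ⊤) :
    Integrable (fun x => ⟪curl W x, fderiv ℝ W x (curl W x)⟫_ℝ) := by
  have hZ := integrable_sq_norm_curl hW h1
  have hcurl : Continuous (curl W) := (contDiff_curl (n := 0) (contDiff_infty.1 hW 1)).continuous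
  have hDW : Continuous (fderiv ℝ W) := (contDiff_infty.1 hW 1).continuous_fderiv one_ne_zero
  refine (hZ.const_mul B).mono' (hcurl.inner (hDW.clm_apply hcurl)).aestronglyMeasurable
    (Eventually.of_forall fun x => ?_)
  rw [Real.norm_eq_abs]
  calc |⟪curl W x, fderiv ℝ W x (curl W x)⟫_ℝ| ≤ ‖curl W x‖ * ‖fderiv ℝ W x (curl W x)‖ := abs_real_inner_le_norm _ _
    _ ≤ ‖curl W x‖ * (‖fderiv ℝ W x‖ * ‖curl W x‖) :=
        mul_le_mul_of_nonneg_left (ContinuousLinearMap.le_opNorm _ _) (norm_nonneg _)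
    _ ≤ ‖curl W x‖ * (B * ‖curl W x‖) := by gcongr; exact hB x
    _ = B * ‖curl W x‖ ^ 2 := by ring

end FiniteBudget

/-! ### Non-triviality: `curl W ≢ 0` with finite budgets forces `Z > 0` and `P > 0` -/

section Nontrivial

variable {W : EuclideanSpace ℝ (Fin 3) → EuclideanSpace ℝ (Fin 3)}

/-- A continuous function with a non-zero value has positive `∫ ‖·‖²` (when integrable). [folklore] -/
theorem integral_sq_norm_pos_of_ne_zero {F : Type*} [NormedAddCommGroup F] {f : EuclideanSpace ℝ (Fin 3) → F}
    (hf : Continuous f) (hint : Integrable (fun x => ‖f x‖ ^ 2)) {x₀ : EuclideanSpace ℝ (Fin 3)} (hx₀ : f x₀ ≠ 0) :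
    0 < ∫ x, ‖f x‖ ^ 2 := by
  have hc : Continuous fun x => ‖f x‖ ^ 2 := hf.norm.pow 2
  have hnn : 0 ≤ fun x => ‖f x‖ ^ 2 := fun x => sq_nonneg _
  rw [integral_pos_iff_support_of_nonneg hnn hint]
  have hx₀' : (0 : ℝ) < ‖f x₀‖ ^ 2 := by positivity
  -- the support contains an open ball around `x₀`
  have hopen : IsOpen (Function.support fun x => ‖f x‖ ^ 2) := hc.isOpen_support
  exact hopen.measure_pos volume ⟨x₀, hx₀'.ne'⟩

/-- If `D(curl W) ≡ 0` (as `|·|²_F` has zero integral) and `∫‖curl W‖² < ∞`, then `curl W ≡ 0`. [folklore] -/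
theorem curl_eq_zero_of_palinstrophy_eq_zero (hW : ContDiff ℝ ∞ W)
    (hZ : Integrable (fun x => ‖curl W x‖ ^ 2))
    (hP : Integrable (fun x => frobeniusNormSq (fderiv ℝ (curl W) x)))
    (hP0 : ∫ x, frobeniusNormSq (fderiv ℝ (curl W) x) = 0) : ∀ x, curl W x = 0 := by
  have hW2 : ContDiff ℝ 2 W := contDiff_infty.1 hW 2
  have hc1 : ContDiff ℝ 1 (curl W) := contDiff_curl (n := 1) (by exact_mod_cast hW2)
  have hDcurl : Continuous (fderiv ℝ (curl W)) := hc1.continuous_fderiv one_ne_zero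
  -- the palinstrophy density vanishes identically
  have hae := (integral_eq_zero_iff_of_nonneg (fun x => frobeniusNormSq_nonneg' _) hP).1 hP0
  have hcont : Continuous fun x => frobeniusNormSq (fderiv ℝ (curl W) x) := continuous_frobeniusNormSq.comp hDcurl
  have hzero : ∀ x, frobeniusNormSq (fderiv ℝ (curl W) x) = 0 := by
    have h := Continuous.ae_eq_iff_eq volume hcont continuous_const |>.1 hae
    exact fun x => congrFun h x
  -- hence `D(curl W) ≡ 0` and `curl W` is constant
  have hD0 : ∀ x, fderiv ℝ (curl W) x = 0 := by
    intro x
    have h := sq_opNorm_le_frobeniusNormSq (fderiv ℝ (curl W) x)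
    rw [hzero x] at h
    have h' : ‖fderiv ℝ (curl W) x‖ = 0 := by nlinarith [norm_nonneg (fderiv ℝ (curl W) x)]
    exact norm_eq_zero.1 h'
  have hconst : ∀ x, curl W x = curl W 0 := fun x =>
    is_const_of_fderiv_eq_zero (hc1.differentiable one_ne_zero) hD0 x 0
  -- a non-zero constant is not square integrable on `ℝ³`
  by_contra hne
  push Not at hne
  obtain ⟨x₁, hx₁⟩ := hne
  have hc0 : curl W 0 ≠ 0 := by rwa [← hconst x₁]
  have hfun : (fun x => ‖curl W x‖ ^ 2) = fun _ => ‖curl W 0‖ ^ 2 := funext fun x => by rw [hconst x]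
  rw [hfun] at hZ
  have h := (integrable_const_iff (μ := (volume : Measure (EuclideanSpace ℝ (Fin 3)))) (c := ‖curl W 0‖ ^ 2)).1 hZ
  have huniv : (volume : Measure (EuclideanSpace ℝ (Fin 3))) univ = ⊤ := by
    haveI : NoncompactSpace (EuclideanSpace ℝ (Fin 3)) := NormedSpace.noncompactSpace ℝ _
    exact measure_univ_of_isAddLeftInvariant _
  rcases h with h | h
  · exact hc0 (by simpa using h)
  · first
      | exact absurd huniv (ne_of_lt h)
      | (haveI := h; exact absurd huniv (measure_lt_top (volume : Measure (EuclideanSpace ℝ (Fin 3))) univ).ne)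

end Nontrivial

/-! ### The dichotomy -/

section Dichotomy

/-- **Limit dichotomy (back end of T1 `CoherentSelection`).** Let `W₀ : ℝ³ → ℝ³` be smooth and divergence free with
`‖W₀‖ ≤ M` (`M > 0`), `‖DW₀‖ ≤ B`, not irrotational, and `(κ⋆ − δ_k)`-efficient at height `M` on an exhaustion: bounded
measurable `D k ⊇ B(0, ρ k)` with `ρ k → ∞`, `δ k → 0` and
`(κ⋆ − δ k)·M·√(∫_{D k}‖curl W₀‖²)·√(∫_{D k}|D curl W₀|²_F) ≤ |∫_{D k}⟪curl W₀, DW₀ curl W₀⟫|`.  Then `W₀` is an exactly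
extremal extended slice (finite budget) or a tube slice (infinite budget). [folklore] -/
theorem isExtremalSlice_or_isTubeSlice_of_exhaustion
    {W₀ : EuclideanSpace ℝ (Fin 3) → EuclideanSpace ℝ (Fin 3)} (hW : ContDiff ℝ ∞ W₀)
    (hdiv : Literature.Analysis.FluidPDE.VectorCalculus.IsDivFree W₀) {M B : ℝ} (hM : 0 < M)
    (hWM : ∀ x, ‖W₀ x‖ ≤ M) (hWB : ∀ x, ‖fderiv ℝ W₀ x‖ ≤ B) (hnt : ∃ x₀, curl W₀ x₀ ≠ 0)
    {D : ℕ → Set (EuclideanSpace ℝ (Fin 3))} {ρ δ : ℕ → ℝ} (hρ : Tendsto ρ atTop atTop) (hδ : Tendsto δ atTop (𝓝 0))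
    (hD : ∀ k, MeasurableSet (D k) ∧ Metric.ball 0 (ρ k) ⊆ D k ∧ Bornology.IsBounded (D k) ∧
      (kStar - δ k) * M * Real.sqrt (∫ x in D k, ‖curl W₀ x‖ ^ 2) *
          Real.sqrt (∫ x in D k, frobeniusNormSq (fderiv ℝ (curl W₀) x)) ≤
        |∫ x in D k, ⟪curl W₀ x, fderiv ℝ W₀ x (curl W₀ x)⟫_ℝ|) :
    IsExtremalSlice W₀ ∨ IsTubeSlice W₀ := by
  by_cases hfin : (∫⁻ x, ‖iteratedFDeriv ℝ 1 W₀ x‖ₑ ^ 2 < ⊤) ∧ (∫⁻ x, ‖iteratedFDeriv ℝ 2 W₀ x‖ₑ ^ 2 < ⊤)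
  · -- FINITE BUDGET: pass to the limit along the exhaustion
    left
    obtain ⟨h1, h2⟩ := hfin
    have hZi := integrable_sq_norm_curl hW h1
    have hPi := integrable_frobeniusNormSq_fderiv_curl' hW h2
    have hJi := integrable_stretching hW hWB h1
    set Z : ℝ := ∫ x, ‖curl W₀ x‖ ^ 2 with hZdef
    set P : ℝ := ∫ x, frobeniusNormSq (fderiv ℝ (curl W₀) x) with hPdef
    set J : ℝ := ∫ x, ⟪curl W₀ x, fderiv ℝ W₀ x (curl W₀ x)⟫_ℝ with hJdef
    have hDm : ∀ k, MeasurableSet (D k) := fun k => (hD k).1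
    have hball : ∀ k, Metric.ball 0 (ρ k) ⊆ D k := fun k => (hD k).2.1
    have tZ : Tendsto (fun k => ∫ x in D k, ‖curl W₀ x‖ ^ 2) atTop (𝓝 Z) :=
      tendsto_setIntegral_of_exhaustion hZi hDm hball hρ
    have tP : Tendsto (fun k => ∫ x in D k, frobeniusNormSq (fderiv ℝ (curl W₀) x)) atTop (𝓝 P) :=
      tendsto_setIntegral_of_exhaustion hPi hDm hball hρ
    have tJ : Tendsto (fun k => ∫ x in D k, ⟪curl W₀ x, fderiv ℝ W₀ x (curl W₀ x)⟫_ℝ) atTop (𝓝 J) :=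
      tendsto_setIntegral_of_exhaustion hJi hDm hball hρ
    -- the efficiency inequality in the limit
    have tL : Tendsto (fun k => (kStar - δ k) * M * Real.sqrt (∫ x in D k, ‖curl W₀ x‖ ^ 2) *
        Real.sqrt (∫ x in D k, frobeniusNormSq (fderiv ℝ (curl W₀) x))) atTop
        (𝓝 ((kStar - 0) * M * Real.sqrt Z * Real.sqrt P)) :=
      (((tendsto_const_nhds.sub hδ).mul tendsto_const_nhds).mul (tZ.sqrt)).mul (tP.sqrt)
    have tR : Tendsto (fun k => |∫ x in D k, ⟪curl W₀ x, fderiv ℝ W₀ x (curl W₀ x)⟫_ℝ|) atTop (𝓝 |J|) := tJ.abs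
    have hlim : kStar * M * Real.sqrt Z * Real.sqrt P ≤ |J| := by
      have h := le_of_tendsto_of_tendsto' tL tR fun k => (hD k).2.2.2
      rwa [sub_zero] at h
    -- non-triviality: `Z > 0` and `P > 0`
    obtain ⟨x₀, hx₀⟩ := hnt
    have hcurlc : Continuous (curl W₀) := (contDiff_curl (n := 0) (contDiff_infty.1 hW 1)).continuous
    have hZpos : 0 < Z := integral_sq_norm_pos_of_ne_zero hcurlc hZi hx₀
    have hPpos : 0 < P := by
      rcases (integral_nonneg (f := fun x => frobeniusNormSq (fderiv ℝ (curl W₀) x))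
        (fun x => frobeniusNormSq_nonneg' (fderiv ℝ (curl W₀) x))).lt_or_eq with h | h
      · exact h
      · exact absurd (curl_eq_zero_of_palinstrophy_eq_zero hW hZi hPi h.symm x₀) hx₀
    have hprod : 0 < M * Real.sqrt Z * Real.sqrt P :=
      mul_pos (mul_pos hM (Real.sqrt_pos.2 hZpos)) (Real.sqrt_pos.2 hPpos)
    refine ⟨hW, hdiv, ⟨B, hWB⟩, h1, h2, M, hWM, hprod, ?_⟩
    -- the literal `sInf {κ | …}` of the text of record is `kStar`
    show kStar * M * Real.sqrt Z * Real.sqrt P ≤ |J|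
    exact hlim
  · -- INFINITE BUDGET: a tube slice, verbatim
    right
    exact ⟨hW, hdiv, ⟨B, hWB⟩, hfin, M, D, ρ, δ, hWM, hρ, hδ, hD⟩

end Dichotomy

end Summit.NavierStokesRegularity.NavierStokesRegularity.Theorems.NearExtremalTransiencePerFlow.MemberSelection
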